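import Summits.Ventures.LatticeQCDFlow.Scaling.FlowGraphSharpLaw
import Summits.Ventures.LatticeQCDFlow.Scaling.GraphSchemeDistanceProfile

/-!
HONEST FRAMING: exact (Metropolis-corrected) sampling algorithms for lattice gauge theory; figures
of merit are autocorrelation/cost numbers at stated couplings and volumes; no continuum-physics
claim.

# FlowGraphDistanceProfile — PERFECT CONSISTENT TRANSPORTS ON ANY CONNECTED SWAP LIST: THE MAP-ASSISTED SCHEME'S DISTANCE TO `⊗μ` DECAYS AT THE EXACT RATE `ρ_G = γ`:
# **`d(n) ≤ (h/ρ_G)(1−ρ_G)ⁿ`** AND **`(1/ρ_G − 1)·log(1/(2ε)) ≤ t_mix(ε) ≤ ⌈(1/ρ_G)·log(h/(ρ_Gε))⌉`** FOR EVERY `ε > 0` — ARBITRARY COLD LAWS (lean-2 GEN-48, ours)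

Venture-side (OURS).  Cell `lqcd-flow` (pub-lqcd), unit `pub-lqcd-lean-2-g48`, 2026-09-01.  Chapter AI (the sizes of the Robin ground state), file 21 — parents AI11 `FlowGraphSharpLaw` (the conjugation
transfer, `γ = ρ_G`), AI16 `GraphSchemeDistanceProfile`.  AI16's profile for the homogeneous scheme, read through AI11's equality of distance profiles for the map-assisted scheme
`t·ptGraphSwap μ e φ + (1−t)·prodKernel w M` with consistent perfect maps `φ_r = L_{l_r}⁻¹∘L_{i_r}`, `μ_i∘L_i⁻¹ = μ_0`, exact hot sampler, idle cold replicas (`h = (1−t)w_0`).  No definitions.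

* `flowGraphPerfect_two_sided_eps`.

Literature grade (cell rule): OWN; nothing cited; no new bib keys.
-/

noncomputable section

open Finset Function
open Literature.Probability.MarkovChains

namespace Summit.Ventures.LatticeQCDFlow.Scaling

variable {S : Type*} [Fintype S] [DecidableEq S] {K m : ℕ} {μ : Fin (K + 1) → S → ℝ} {M : Fin (K + 1) → S → S → ℝ} {w : Fin (K + 1) → ℝ} {t : ℝ}
  {e : Fin m → Fin (K + 1) × Fin (K + 1)}

/-- **PERFECT CONSISTENT TRANSPORTS — THE `ε`-PROFILE:** `L_0 = 1`, `μ_i∘L_i⁻¹ = μ_0` for every level, `μ_0 > 0` a probability vector, exact hot sampler, idle cold kernels, `w` a probability vector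
with `w_0 > 0`, `0 < t < 1`, `m ≥ 1`, distinct endpoints, connected list, `|S| ≥ 2`, `h = (1−t)w_0`; then with `ρ = γ_{⊗μ}(P^φ)` (`ρ(K+1) ≤ h`): **`d(n) ≤ (h/ρ)(1−ρ)ⁿ` for every `n` and
`(1/ρ − 1)·log(1/(2ε)) ≤ t_mix(P^φ; ε) ≤ ⌈(1/ρ)·log(h/(ρε))⌉` for every `ε > 0`**. [ours] -/
theorem flowGraphPerfect_two_sided_eps [Nontrivial S] (L : Fin (K + 1) → Equiv.Perm S) (hL0 : L 0 = Equiv.refl S) (hm : 1 ≤ m) (he : ∀ r, (e r).1 ≠ (e r).2)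
    (hconn : ∀ A : Finset (Fin (K + 1)), A.Nonempty → A ≠ univ → ∃ r : Fin m, ((e r).1 ∈ A ∧ (e r).2 ∉ A) ∨ ((e r).2 ∈ A ∧ (e r).1 ∉ A))
    (hμ0 : ∀ v, 0 < μ 0 v) (hμ01 : ∑ v, μ 0 v = 1) (hM0 : ∀ u v, M 0 u v = μ 0 v) (hidle : ∀ i : Fin K, ∀ u v, M i.succ u v = if v = u then 1 else 0)
    (hw0 : ∀ k, 0 ≤ w k) (hw00 : 0 < w 0) (hw1 : ∑ k, w k = 1) (ht0 : 0 < t) (ht1 : t < 1)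
    (hperf : ∀ (i : Fin (K + 1)) (u : S), μ i ((L i).symm u) = μ 0 u) {ε : ℝ} (hε : 0 < ε) :
    ∃ ρ : ℝ, 0 < ρ ∧ ρ * ((K : ℝ) + 1) ≤ (1 - t) * w 0 ∧
      spectralGap (tensorFun μ) (fun x y : Fin (K + 1) → S => t * ptGraphSwap μ e (fun r => (L (e r).1).trans (L (e r).2).symm) x y + (1 - t) * prodKernel w M x y) = ρ ∧
      (∀ n : ℕ, worstTvDist (fun x y : Fin (K + 1) → S => t * ptGraphSwap μ e (fun r => (L (e r).1).trans (L (e r).2).symm) x y + (1 - t) * prodKernel w M x y) (tensorFun μ) n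
        ≤ (1 - t) * w 0 / ρ * (1 - ρ) ^ n) ∧
      (1 / ρ - 1) * Real.log (1 / (2 * ε))
        ≤ (mixingTime (fun x y : Fin (K + 1) → S => t * ptGraphSwap μ e (fun r => (L (e r).1).trans (L (e r).2).symm) x y + (1 - t) * prodKernel w M x y) (tensorFun μ) ε : ℝ) ∧
      mixingTime (fun x y : Fin (K + 1) → S => t * ptGraphSwap μ e (fun r => (L (e r).1).trans (L (e r).2).symm) x y + (1 - t) * prodKernel w M x y) (tensorFun μ) ε
        ≤ ⌈1 / ρ * Real.log ((1 - t) * w 0 / (ρ * ε))⌉₊ := by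
  have hν : (fun (i : Fin (K + 1)) (u : S) => μ i ((L i).symm u)) = fun _ : Fin (K + 1) => μ 0 := funext fun i => funext fun u => hperf i u
  have hd : ∀ n, worstTvDist (fun x y : Fin (K + 1) → S => t * ptGraphSwap μ e (fun r => (L (e r).1).trans (L (e r).2).symm) x y + (1 - t) * prodKernel w M x y) (tensorFun μ) n
      = worstTvDist (fun x y : Fin (K + 1) → S => t * ptGraphSwap (fun _ : Fin (K + 1) => μ 0) e (fun _ : Fin m => Equiv.refl S) x y
          + (1 - t) * prodKernel w (fun i u v => M i ((L i).symm u) ((L i).symm v)) x y) (tensorFun (fun _ : Fin (K + 1) => μ 0)) n := by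
    intro n; rw [flowGraph_worstTvDist_eq L he t w μ M n, hν]
  have hgap := flowGraph_spectralGap_eq L he t w (μ := μ) (M := M)
  rw [hν] at hgap
  obtain ⟨ρ, hρ0, hrho, hgap', hprof, hfloor, hceil⟩ := graphScheme_mixingTime_two_sided_eps e (M := fun i u v => M i ((L i).symm u) ((L i).symm v)) hm he hconn hμ0 hμ01
    (relabelLadder_hotSampler L hL0 hM0) (relabelLadder_idle L hidle) hw0 hw00 hw1 ht0 ht1 (fun _ _ => rfl) hε
  refine ⟨ρ, hρ0, hrho, by rw [hgap]; exact hgap', fun n => by rw [hd n]; exact hprof n, ?_, ?_⟩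
  · rw [mixingTime_congr_of_worstTvDist hd ε]; exact hfloor
  · rw [mixingTime_congr_of_worstTvDist hd ε]; exact hceil

end Summit.Ventures.LatticeQCDFlow.Scaling

end
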